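import Literature.Probability.RandomPlanarGeometry.HexParafermionModeIdentities
import Literature.Probability.RandomPlanarGeometry.HexSAWTurnLaw
import HarnessLib

/-!
# The two modes of the first arrivals are two characters of one positive law (observable level)

Topic `Literature/Probability/RandomPlanarGeometry`; joins `HexSAWTurnLaw.lean` (coordinate model: the sum mode and the
conjugate-direction mode of the first arrivals at a vertex are the `λ`- and `λω⁻¹`-characters of the non-negative turning law
`turnMass`) to `HexParafermionModes.lean` / `HexParafermionModeIdentities.lean` (transport to the observable
`F(a, ·, x_c, 5/8)` of a hexagonal domain, `F = A + L + D`, `B(F) = κ_B B(A) + B(L)`, `M(F) = κ_M M(A) + M(L)`).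
Source: H. Duminil-Copin, S. Smirnov, Ann. of Math. 175 (2012), 1653–1665 (arXiv:1007.0575), §2 (winding as total rotation;
Definition 1; proof of Lemma 1).

* `HV.normSq_edir`: all darts of the coordinate honeycomb have squared length `3`.
* **`firstArrival_modes_eq_characters`**: for a boundary mid-edge `a`, `v ∈ Λ` and a CLOCKWISE frame `(w₀, w₁, w₂)` there are a
  finitely supported law `o : ℤ → ℝ≥0` (the `x_c`-masses of the first arrivals at `v` by total turning `J`) and a unit `c` with
  `A₀ + A₁ + A₂ = Σ_J o_J λ^J` and `A₀ + ωA₁ + ω²A₂ = c · Σ_J o_J (λω⁻¹)^J` (`λ = e^{-i5π/24}`, `ω = ζ² = e^{2πi/3}`, and the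
  coordinate `ω` of `HV` is `e^{iπ/3}`: `λ·omg⁻¹ = e^{-i97.5°}`).

So at every vertex the Beltrami quotient of the observable is `‖κ_B c ĝ(λ omg⁻¹) + B(L)‖ / ‖κ_M ĝ(λ) + M(L)‖` for the two
characters `ĝ` of ONE non-negative law — the lattice content of DCS's conjectured orientation-independence (p. 7) at a vertex is a
statement about the fine structure of this law (and the loop walks). Deliberately NOT here: anything asymptotic.
-/

noncomputable section

open Finset Literature.Probability.LatticeModels Literature.Probability.Percolation

namespace Literature.Probability.RandomPlanarGeometry.SAW

namespace HV

/-- **All darts have squared length `3`** in the coordinate embedding `emb ∘ pos`. [folklore] -/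
theorem normSq_edir {u v : HV} (h : hvGraph.Adj u v) : Complex.normSq (edir u v) = 3 := by
  have h3 : Real.sqrt 3 ^ 2 = 3 := Real.sq_sqrt (by norm_num)
  have key : ∀ x y : ℤ, ((x = 1 ∧ y = 1) ∨ (x = -2 ∧ y = 1) ∨ (x = 1 ∧ y = -2) ∨ (x = -1 ∧ y = -1) ∨
      (x = 2 ∧ y = -1) ∨ (x = -1 ∧ y = 2)) → Complex.normSq (emb (x, y)) = 3 := by
    rintro x y hxy
    rw [Complex.normSq_apply, emb_re, emb_im]
    rcases hxy with ⟨rfl, rfl⟩ | ⟨rfl, rfl⟩ | ⟨rfl, rfl⟩ | ⟨rfl, rfl⟩ | ⟨rfl, rfl⟩ | ⟨rfl, rfl⟩ <;> push_cast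
    · linear_combination (1 / 4 : ℝ) * h3
    · linear_combination (1 / 4 : ℝ) * h3
    · linear_combination h3
    · linear_combination (1 / 4 : ℝ) * h3
    · linear_combination (1 / 4 : ℝ) * h3
    · linear_combination h3
  rw [edir]
  obtain ⟨a, b, c⟩ := u
  obtain ⟨a', b', c'⟩ := v
  have hpos : ∀ x y : ℤ, pos (a', b', c') - pos (a, b, c) = (x, y) →
      ((x = 1 ∧ y = 1) ∨ (x = -2 ∧ y = 1) ∨ (x = 1 ∧ y = -2) ∨ (x = -1 ∧ y = -1) ∨
        (x = 2 ∧ y = -1) ∨ (x = -1 ∧ y = 2)) → Complex.normSq (emb (pos (a', b', c') - pos (a, b, c))) = 3 :=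
    fun x y e hxy => by rw [e]; exact key x y hxy
  cases c <;> cases c' <;> simp only [hvGraph_adj, AdjRel] at h <;> simp at h <;>
    rcases h with ⟨rfl, rfl⟩ | ⟨rfl, rfl⟩ | ⟨rfl, rfl⟩
  · exact hpos 1 1 (by simp [pos]) (by omega)
  · exact hpos (-2) 1 (by simp [pos, Prod.ext_iff]; omega) (by omega)
  · exact hpos 1 (-2) (by simp [pos, Prod.ext_iff]; omega) (by omega)
  · exact hpos (-1) (-1) (by simp [pos]) (by omega)
  · exact hpos 2 (-1) (by simp [pos, Prod.ext_iff]; omega) (by omega)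
  · exact hpos (-1) 2 (by simp [pos, Prod.ext_iff]; omega) (by omega)

/-- Darts have norm `√3`. [folklore] -/
theorem norm_edir {u v : HV} (h : hvGraph.Adj u v) : ‖edir u v‖ = Real.sqrt 3 := by
  rw [← Real.sqrt_sq (norm_nonneg _), Complex.sq_norm, normSq_edir h]

end HV

section TurnLaw

open HV

variable {Λ : Finset HexVertex} {a : Sym2 HexVertex} {v w₀ w₁ w₂ : HexVertex}

/-- **The two modes of the first arrivals are two characters of ONE non-negative law.** For a boundary mid-edge `a`,
`v ∈ Λ` and a clockwise frame (`c w₁ - c v = ζ⁴ (c w₀ - c v)`, `c w₂ - c v = ζ² (c w₀ - c v)`), at `x = x_c`, `σ = 5/8`: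
there are `o : ℤ → ℝ` with `o ≥ 0`, a finite set `T` and a complex UNIT `c` such that
`A₀ + A₁ + A₂ = Σ_{J ∈ T} o_J λ^J` and `A₀ + ζ²A₁ + ζ⁴A₂ = c Σ_{J ∈ T} o_J (λ omg⁻¹)^J`
(`o_J` = `x_c`-mass of the first arrivals at `v` with total turning `J`; `λ = e^{-i5π/24}`, `omg = e^{iπ/3}`).
[cite: DuminilCopinSmirnov2012, §2 (winding; Definition 1; proof of Lemma 1)] -/
theorem firstArrival_modes_eq_characters (ha : a ∈ hexDomainBoundary Λ) (hv : v ∈ Λ)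
    (h₀ : hexGraph.Adj v w₀) (h₁ : hexGraph.Adj v w₁) (h₂ : hexGraph.Adj v w₂) (h01 : w₀ ≠ w₁) (h12 : w₁ ≠ w₂)
    (h02 : w₀ ≠ w₂) (hd₁ : hexCenter w₁ - hexCenter v = triZeta ^ 4 * (hexCenter w₀ - hexCenter v))
    (hd₂ : hexCenter w₂ - hexCenter v = triZeta ^ 2 * (hexCenter w₀ - hexCenter v)) :
    ∃ (o : ℤ → ℝ) (T : Finset ℤ) (c : ℂ), (∀ J, 0 ≤ o J) ∧ ‖c‖ = 1 ∧
      firstArrivalObservable Λ a hexCriticalFugacity (5 / 8) v w₀ +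
            firstArrivalObservable Λ a hexCriticalFugacity (5 / 8) v w₁ +
              firstArrivalObservable Λ a hexCriticalFugacity (5 / 8) v w₂ =
          ∑ J ∈ T, (o J : ℂ) * lam ^ J ∧
        firstArrivalObservable Λ a hexCriticalFugacity (5 / 8) v w₀ +
            triZeta ^ 2 * firstArrivalObservable Λ a hexCriticalFugacity (5 / 8) v w₁ +
              triZeta ^ 4 * firstArrivalObservable Λ a hexCriticalFugacity (5 / 8) v w₂ =
          c * ∑ J ∈ T, (o J : ℂ) * (lam * omg⁻¹) ^ J := by
  classical
  obtain ⟨haE, u, x₁, rfl, hx₁, hu⟩ := ha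
  have hux : hexGraph.Adj u x₁ := (SimpleGraph.mem_edgeSet hexGraph).1 haE
  obtain ⟨Φ, α, β, hα, hΦu, hΦw, haff⟩ := exists_chart hux
  set V := Λ.map Φ.toEquiv.toEmbedding with hV
  have hw : wOut ∉ V := by
    intro h
    obtain ⟨y, hy, hyu⟩ := Finset.mem_map.1 h
    change Φ y = wOut at hyu
    exact hu (Φ.injective (hyu.trans hΦu.symm) ▸ hy)
  have h0' : hvGraph.Adj (Φ v) (Φ w₀) := (Φ.map_rel_iff).2 h₀
  have h1' : hvGraph.Adj (Φ v) (Φ w₁) := (Φ.map_rel_iff).2 h₁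
  have h2' : hvGraph.Adj (Φ v) (Φ w₂) := (Φ.map_rel_iff).2 h₂
  -- the law, its support, the unit
  set d := hexCenter w₀ - hexCenter v with hd_def
  have hd : d ≠ 0 := sub_ne_zero.2 (hexCenter_ne_of_adj h₀).symm
  have e0 : edir wOut hvOrigin ≠ 0 := edir_ne_zero adj_wOut_hvOrigin
  refine ⟨turnMass V (Φ v), (clsIn V (Φ v)).image pturn, -(edir (Φ v) (Φ w₀)) * (edir wOut hvOrigin)⁻¹,
    turnMass_nonneg, ?_, ?_, ?_⟩
  · rw [norm_mul, norm_neg, norm_inv, norm_edir h0', norm_edir adj_wOut_hvOrigin,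
      mul_inv_cancel₀ (Real.sqrt_ne_zero'.2 (by norm_num))]
  · -- sum mode
    have hs := sum_split_three (S := clsIn V (Φ v)) (π := fun P => (finalDart P).1) (fun _ => (1 : ℂ)) h0' h1' h2'
      (Φ.injective.ne h01) (Φ.injective.ne h12) (Φ.injective.ne h02) (fun P hP => adj_of_mem_clsIn hP)
    simp only [one_mul] at hs
    rw [firstArrivalObservable_eq rfl hu hx₁ hux hΦu hΦw haff hα h₀ hv,
      firstArrivalObservable_eq rfl hu hx₁ hux hΦu hΦw haff hα h₁ hv,
      firstArrivalObservable_eq rfl hu hx₁ hux hΦu hΦw haff hα h₂ hv, ← hs, sum_clsIn_pwt_eq]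
  · -- Beltrami mode
    have hs := sum_split_three (S := clsIn V (Φ v)) (π := fun P => (finalDart P).1) (fun y => (edir (Φ v) y)⁻¹)
      h0' h1' h2' (Φ.injective.ne h01) (Φ.injective.ne h12) (Φ.injective.ne h02) (fun P hP => adj_of_mem_clsIn hP)
    rw [sum_clsIn_inv_edir_pwt_eq hw, ← firstArrivalObservable_eq rfl hu hx₁ hux hΦu hΦw haff hα h₀ hv,
      ← firstArrivalObservable_eq rfl hu hx₁ hux hΦu hΦw haff hα h₁ hv,
      ← firstArrivalObservable_eq rfl hu hx₁ hux hΦu hΦw haff hα h₂ hv,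
      edir_chart haff, edir_chart haff, edir_chart haff] at hs
    -- `hs : -(e₀)⁻¹ Σ_J … = (2α(mid₀-v))⁻¹ A₀ + (2α(mid₁-v))⁻¹ A₁ + (2α(mid₂-v))⁻¹ A₂`
    have hm : ∀ w, hexMidpoint s(v, w) - hexCenter v = (hexCenter w - hexCenter v) / 2 := fun w => by
      rw [hexMidpoint_mk]; ring
    rw [hm, hm, hm, hd₁, hd₂] at hs
    have h2α : (2 : ℂ) * α ≠ 0 := mul_ne_zero two_ne_zero hα
    have i0 : (2 * α * (d / 2))⁻¹ = α⁻¹ * d⁻¹ := by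
      rw [show 2 * α * (d / 2) = α * d by ring, mul_inv]
    have i4 : (2 * α * (triZeta ^ 4 * d / 2))⁻¹ = α⁻¹ * d⁻¹ * triZeta ^ 2 := by
      rw [show 2 * α * (triZeta ^ 4 * d / 2) = α * (triZeta ^ 4 * d / 2 * 2) by ring, mul_inv, mul_inv,
        inv_rot_half hd 4 2 rfl]
      field_simp
    have i2 : (2 * α * (triZeta ^ 2 * d / 2))⁻¹ = α⁻¹ * d⁻¹ * triZeta ^ 4 := by
      rw [show 2 * α * (triZeta ^ 2 * d / 2) = α * (triZeta ^ 2 * d / 2 * 2) by ring, mul_inv, mul_inv,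
        inv_rot_half hd 2 4 rfl]
      field_simp
    rw [i0, i4, i2] at hs
    have hchart : edir (Φ v) (Φ w₀) = α * d := by rw [edir_chart haff, hm]; ring
    rw [hchart]
    have key := congrArg (fun z => α * d * z) hs
    simp only [mul_add] at key
    have c1 : ∀ z : ℂ, α * d * (α⁻¹ * d⁻¹ * z) = z := fun z => by
      rw [show α * d * (α⁻¹ * d⁻¹ * z) = (α * α⁻¹) * (d * d⁻¹) * z by ring, mul_inv_cancel₀ hα,
        mul_inv_cancel₀ hd, one_mul, one_mul]
    have c2 : ∀ z e : ℂ, α * d * (α⁻¹ * d⁻¹ * e * z) = e * z := fun z e => by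
      rw [show α * d * (α⁻¹ * d⁻¹ * e * z) = (α * α⁻¹) * (d * d⁻¹) * (e * z) by ring, mul_inv_cancel₀ hα,
        mul_inv_cancel₀ hd, one_mul, one_mul]
    simp only [c1, c2] at key
    rw [← key]
    ring

end TurnLaw

end Literature.Probability.RandomPlanarGeometry.SAW

end
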